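import Literature.NumberTheory.EllipticCurves.SupersingularDivisionPolynomialProofs
import HarnessLib

/-!
# The valuation of the `ℓ`-torsion at an unramified place of good supersingular reduction

`Proofs` file (theorems only, no definitions, no named facts), topic `NumberTheory/EllipticCurves`.
Serre, *Propriétés galoisiennes des points d'ordre fini des courbes elliptiques* (1972), §1.11,
Prop. 12 (`e = 1`, supersingular): the points of order `ℓ` of an elliptic curve with good
supersingular reduction over an absolutely unramified local field of residue characteristic `ℓ`
lie in the kernel of reduction at "level `1/(ℓ² - 1)`", i.e. the formal-group parameter
`z = -x/y` of every `P ∈ E[ℓ] ∖ 0` has `|z|^{ℓ²-1} = |ℓ|`, so `|x(P)|^{(ℓ²-1)/2} = |ℓ|⁻¹`.  We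
prove the `x`-coordinate statement from the division polynomial `ψ_ℓ`, whose shape at such a
place is `ψ_ℓ = ℓ·x^{(ℓ²-1)/2} + 𝔪(…) + unit` with `𝔪 = (ℓ)`
(`WeierstrassCurve.coeff_preΨ'_prime_of_hasseCoeff_mem_maximalIdeal`, file
`SupersingularDivisionPolynomialProofs`, Debry's criterion: `ψ_ℓ` of a supersingular curve is a
non-zero constant), by a two-term domination argument:

* `Literature.NumberTheory.EllipticCurves.one_lt_valuation_and_mul_pow_eq_one_of_eval_eq_zero` —
  for a polynomial `f = Σ cᵢ xⁱ` of degree `≤ n` over a valued field with `|c₀| = 1`,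
  `|cₙ| < 1` and `|cᵢ| ≤ |cₙ|` for `0 < i < n`, **every root `x` has `|x| > 1` and
  `|cₙ|·|x|ⁿ = 1`** (the only two terms that can dominate are `c₀` and `cₙxⁿ`);
* `WeierstrassCurve.one_lt_valuation_X_of_prime_zsmul_eq_zero` — hence, for a Weierstrass equation
  over a valued field of residue characteristic `ℓ` (odd) whose `ψ_ℓ = preΨ'_ℓ` has unit constant
  term and all other coefficients of valuation `≤ |ℓ|`, **every affine point `P = (x, y)` with
  `ℓ • P = O` has `|x| > 1` and `|ℓ|·|x|^{(ℓ²-1)/2} = 1`** (`ΨSq_ℓ(x) = ψ_ℓ(x)² = 0`,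
  `zsmul_some_eq_zero_iff_eval_ΨSq`; Mathlib `natDegree_preΨ'`, `coeff_preΨ'`: `ψ_ℓ` has degree
  `(ℓ² - 1)/2` and leading coefficient `ℓ`);
* `WeierstrassCurve.one_lt_valuation_X_of_prime_zsmul_eq_zero_of_hasseCoeff_mem` — the same for
  the base change of a Weierstrass equation `M` over a local ring `R → L` mapping into the
  valuation ring, with finite residue field of characteristic `ℓ`, `Δ(M) ∈ Rˣ`, `A_ℓ(M) ∈ 𝔪_R`
  (**good supersingular reduction**) and `𝔪_R ⊆ ℓR` (**absolutely unramified**: `e = 1`).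

## References

* [Serre1972] J.-P. Serre, Invent. Math. 15 (1972), §1.11, Prop. 12 (and §1.9–1.10).
* [SilvermanAEC2009] J. H. Silverman, *The Arithmetic of Elliptic Curves*, 2nd ed. (2009),
  Exercise 3.7, IV.6–7, VII.3.
-/

noncomputable section

open scoped Classical NNReal
open Polynomial

universe u

namespace Literature.NumberTheory.EllipticCurves

variable {L : Type u} [Field L] {w : Valuation L ℝ≥0}

/-- **Two-term domination.**  Let `f = Σᵢ cᵢ xⁱ` have degree `≤ n` over a valued field, with
`|c₀| = 1`, `|cₙ| < 1` and `|cᵢ| ≤ |cₙ|` for `0 < i < n`.  Then every root `x` of `f` satisfies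
`|x| > 1` and `|cₙ|·|x|ⁿ = 1`: if `|x| ≤ 1` every term but `c₀` has absolute value `< 1`; if
`|x| > 1` every middle term is `< |cₙxⁿ|`, so `c₀` and `cₙxⁿ` must cancel in absolute value.
[folklore] -/
theorem one_lt_valuation_and_mul_pow_eq_one_of_eval_eq_zero {f : L[X]} {n : ℕ}
    (hn : f.natDegree ≤ n) (h0 : w (f.coeff 0) = 1) (htop : w (f.coeff n) < 1)
    (hmid : ∀ i, 0 < i → i < n → w (f.coeff i) ≤ w (f.coeff n)) {x : L}
    (hx : f.eval x = 0) : 1 < w x ∧ w (f.coeff n) * w x ^ n = 1 := by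
  rcases Nat.eq_zero_or_pos n with rfl | hn0
  · rw [h0] at htop; exact absurd htop (lt_irrefl 1)
  obtain ⟨m, rfl⟩ : ∃ m, n = m + 1 := ⟨n - 1, by omega⟩
  -- `0 = f(x) = c₀ + (Σ_{0<i<n} cᵢ xⁱ + cₙ xⁿ)`
  set S := ∑ j ∈ Finset.range m, f.coeff (j + 1) * x ^ (j + 1) with hS
  have hsum : f.eval x = f.coeff 0 + (S + f.coeff (m + 1) * x ^ (m + 1)) := by
    rw [eval_eq_sum_range' (Nat.lt_succ_of_le hn), Finset.sum_range_succ, Finset.sum_range_succ',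
      pow_zero, mul_one, hS]
    ring
  rw [hx] at hsum
  have hc0 : f.coeff 0 = -(S + f.coeff (m + 1) * x ^ (m + 1)) :=
    add_eq_zero_iff_eq_neg.mp hsum.symm
  have hw0 : w (S + f.coeff (m + 1) * x ^ (m + 1)) = 1 := by
    rw [← Valuation.map_neg, ← hc0, h0]
  -- the top coefficient is non-zero
  have hcn : f.coeff (m + 1) ≠ 0 := by
    intro hcn
    have hS0 : S = 0 := by
      refine Finset.sum_eq_zero fun j hj ↦ ?_
      rw [Finset.mem_range] at hj
      have := hmid (j + 1) (Nat.succ_pos j) (by omega)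
      rw [hcn, map_zero, le_zero_iff, map_eq_zero] at this
      rw [this, zero_mul]
    rw [hS0, hcn, zero_mul, add_zero, map_zero] at hw0
    exact zero_ne_one hw0
  have hcn0 : 0 < w (f.coeff (m + 1)) := (Valuation.pos_iff _).mpr hcn
  -- first claim: `|x| > 1`
  have h1 : 1 < w x := by
    by_contra hle
    rw [not_lt] at hle
    have hrest : w (S + f.coeff (m + 1) * x ^ (m + 1)) < 1 := by
      refine Valuation.map_add_lt _ ?_ ?_
      · refine Valuation.map_sum_lt _ one_ne_zero fun j hj ↦ ?_
        rw [Finset.mem_range] at hj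
        rw [map_mul, map_pow]
        calc w (f.coeff (j + 1)) * w x ^ (j + 1) ≤ w (f.coeff (m + 1)) * 1 :=
              mul_le_mul' (hmid _ (Nat.succ_pos j) (by omega)) (pow_le_one₀ zero_le hle)
          _ < 1 := by rw [mul_one]; exact htop
      · rw [map_mul, map_pow]
        calc w (f.coeff (m + 1)) * w x ^ (m + 1) ≤ w (f.coeff (m + 1)) * 1 :=
              mul_le_mul_right (pow_le_one₀ zero_le hle) _
          _ < 1 := by rw [mul_one]; exact htop
    rw [hw0] at hrest
    exact lt_irrefl 1 hrest
  refine ⟨h1, ?_⟩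
  -- second claim: the middle terms are dominated by `cₙ xⁿ`
  have hx0 : x ≠ 0 := by
    rintro rfl
    rw [map_zero] at h1
    exact not_lt_zero h1
  have htop0 : w (f.coeff (m + 1) * x ^ (m + 1)) ≠ 0 :=
    (Valuation.ne_zero_iff _).mpr (mul_ne_zero hcn (pow_ne_zero _ hx0))
  have hSlt : w S < w (f.coeff (m + 1) * x ^ (m + 1)) := by
    refine Valuation.map_sum_lt _ htop0 fun j hj ↦ ?_
    rw [Finset.mem_range] at hj
    rw [map_mul, map_pow, map_mul, map_pow]
    calc w (f.coeff (j + 1)) * w x ^ (j + 1) ≤ w (f.coeff (m + 1)) * w x ^ (j + 1) :=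
          mul_le_mul_left (hmid _ (Nat.succ_pos j) (by omega)) _
      _ < w (f.coeff (m + 1)) * w x ^ (m + 1) :=
          mul_lt_mul_of_pos_left (pow_lt_pow_right₀ h1 (by omega)) hcn0
  rw [Valuation.map_add_eq_of_lt_right _ hSlt, map_mul, map_pow] at hw0
  exact hw0

end Literature.NumberTheory.EllipticCurves

namespace WeierstrassCurve

open Literature.NumberTheory.EllipticCurves

variable {L : Type u} [Field L] {w : Valuation L ℝ≥0}

/-- **`|x(P)| > 1` and `|ℓ|·|x(P)|^{(ℓ²-1)/2} = 1` for the points of order `ℓ`** of a Weierstrass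
equation `V` over a valued field of residue characteristic `ℓ` (odd, `ℓ ≠ 0` in `L`) whose
`ℓ`-division polynomial `ψ_ℓ = preΨ'_ℓ` has a unit constant term and all other coefficients of
valuation `≤ |ℓ|` (the shape at an absolutely unramified place of good supersingular reduction):
`ψ_ℓ(x(P))² = ΨSq_ℓ(x(P)) = 0` (`zsmul_some_eq_zero_iff_eval_ΨSq`), `ψ_ℓ` has degree `(ℓ² - 1)/2`
and leading coefficient `ℓ` (Mathlib `natDegree_preΨ'`, `coeff_preΨ'`), and
`one_lt_valuation_and_mul_pow_eq_one_of_eval_eq_zero` applies.  Serre 1972, §1.11 (Prop. 12,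
`e = 1`). [cite: Serre1972, §1.11 Prop. 12] -/
theorem one_lt_valuation_X_of_prime_zsmul_eq_zero (V : WeierstrassCurve L) {ℓ : ℕ}
    [hℓ : Fact ℓ.Prime] (hℓ2 : ℓ ≠ 2) (hℓL : (ℓ : L) ≠ 0) (hℓw : w ℓ < 1)
    (h0 : w ((V.preΨ' ℓ).coeff 0) = 1) (hmid : ∀ i, 0 < i → w ((V.preΨ' ℓ).coeff i) ≤ w ℓ)
    {x y : L} {h : V.toAffine.Nonsingular x y}
    (hP : (ℓ : ℤ) • (Affine.Point.some x y h : V.toAffine.Point) = 0) :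
    1 < w x ∧ w ℓ * w x ^ ((ℓ ^ 2 - 1) / 2) = 1 := by
  have hodd : ¬ Even ℓ := Nat.not_even_iff_odd.mpr (hℓ.out.odd_of_ne_two hℓ2)
  set n : ℕ := (ℓ ^ 2 - 1) / 2 with hn
  have hdeg : (V.preΨ' ℓ).natDegree = n := by
    rw [natDegree_preΨ' _ hℓL, if_neg hodd]
  have hlead : (V.preΨ' ℓ).coeff n = ℓ := by
    have := V.coeff_preΨ' ℓ
    rw [if_neg hodd, if_neg hodd] at this
    exact this
  -- `ψ_ℓ(x) = 0`
  have hΨ : (V.ΨSq ℓ).eval x = 0 := (V.zsmul_some_eq_zero_iff_eval_ΨSq h ℓ).mp hP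
  have hroot : (V.preΨ' ℓ).eval x = 0 := by
    rw [V.ΨSq_ofNat ℓ, if_neg hodd, mul_one, eval_pow] at hΨ
    exact pow_eq_zero_iff two_ne_zero |>.mp hΨ
  have key := one_lt_valuation_and_mul_pow_eq_one_of_eval_eq_zero (w := w) hdeg.le h0
    (by rw [hlead]; exact hℓw) (fun i hi _ ↦ by rw [hlead]; exact hmid i hi) hroot
  rwa [hlead] at key

/-- **The same at an absolutely unramified place of good supersingular reduction.**  Let `R → L`
be a local ring mapping into the valuation ring of `(L, w)`, with finite residue field of odd
characteristic `ℓ` and `𝔪_R ⊆ ℓR` (`e = 1`), `w ℓ < 1`, `ℓ ≠ 0` in `L`; let `M/R` be a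
Weierstrass equation with `Δ(M) ∈ Rˣ` and `A_ℓ(M) ∈ 𝔪_R` (good supersingular reduction).  Then
every affine point `P = (x, y)` of `M_L` with `ℓ • P = O` has `|x| > 1` and
`|ℓ|·|x|^{(ℓ²-1)/2} = 1` (the shape of `ψ_ℓ(M)`:
`coeff_preΨ'_prime_of_hasseCoeff_mem_maximalIdeal`). [cite: Serre1972, §1.11 Prop. 12] -/
theorem one_lt_valuation_X_of_prime_zsmul_eq_zero_of_hasseCoeff_mem {R : Type*} [CommRing R]
    [IsLocalRing R] [Finite (IsLocalRing.ResidueField R)] [Algebra R L] {ℓ : ℕ}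
    [hℓ : Fact ℓ.Prime] [CharP (IsLocalRing.ResidueField R) ℓ] (hℓ2 : ℓ ≠ 2)
    (hR : ∀ c : R, w (algebraMap R L c) ≤ 1)
    (hgen : ∀ c ∈ IsLocalRing.maximalIdeal R, (ℓ : R) ∣ c) (hℓw : w ℓ < 1) (hℓL : (ℓ : L) ≠ 0)
    (M : WeierstrassCurve R) (hΔ : IsUnit M.Δ) (hA : M.hasseCoeff ℓ ∈ IsLocalRing.maximalIdeal R)
    {x y : L} {h : (M.map (algebraMap R L)).toAffine.Nonsingular x y}
    (hP : (ℓ : ℤ) • (Affine.Point.some x y h : (M.map (algebraMap R L)).toAffine.Point) = 0) :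
    1 < w x ∧ w ℓ * w x ^ ((ℓ ^ 2 - 1) / 2) = 1 := by
  obtain ⟨hu, hm⟩ := coeff_preΨ'_prime_of_hasseCoeff_mem_maximalIdeal ℓ hℓ2 M hΔ hA
  have hcoeff : ∀ i, ((M.map (algebraMap R L)).preΨ' ℓ).coeff i =
      algebraMap R L ((M.preΨ' ℓ).coeff i) := fun i ↦ by
    rw [map_preΨ', coeff_map]
  refine one_lt_valuation_X_of_prime_zsmul_eq_zero (M.map (algebraMap R L)) hℓ2 hℓL hℓw ?_ ?_ hP
  · -- the constant term is a unit of `R`, of valuation `1`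
    rw [hcoeff]
    obtain ⟨u, hu'⟩ := hu
    rw [← hu']
    refine le_antisymm (hR _) ?_
    have h1 : w (algebraMap R L (u : R)) * w (algebraMap R L (↑u⁻¹ : R)) = 1 := by
      rw [← map_mul, ← map_mul, Units.mul_inv, map_one, map_one]
    calc (1 : ℝ≥0) = w (algebraMap R L (u : R)) * w (algebraMap R L (↑u⁻¹ : R)) := h1.symm
      _ ≤ w (algebraMap R L (u : R)) * 1 := mul_le_mul_right (hR _) _
      _ = w (algebraMap R L (u : R)) := mul_one _
  · -- the other coefficients lie in `𝔪_R ⊆ ℓR`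
    intro i hi
    rw [hcoeff]
    obtain ⟨c, hc⟩ := hgen _ (hm i hi)
    rw [hc, map_mul, map_natCast, map_mul]
    calc w (ℓ : L) * w (algebraMap R L c) ≤ w ℓ * 1 := mul_le_mul_right (hR c) _
      _ = w ℓ := mul_one _

end WeierstrassCurve

end
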